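import Summits.CriticalPhenomena.SAWScalingLimit.Theorems.SAWTotalPositivityBoundaryTP2Defs
import Summits.CriticalPhenomena.SAWScalingLimit.Theorems.SAWTotalPositivityBoundaryTP2Kernel
import Summits.CriticalPhenomena.SAWScalingLimit.Theorems.SAWTotalPositivityBoundaryTP2Symmetry
import Summits.CriticalPhenomena.SAWScalingLimit.Theorems.EdgeOfPositivity.Negative.EdgeOfPositivityRectDomain
import Literature.Probability.Percolation.PlanarDuality
import HarnessLib

/-!
# Crux `BoundaryTP2` (stmt-CriticalPhenomena-7115), line `Sketch`: stub `stub_strip3_interlaced`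

Tool stub C4 of the line's skeleton (the planar input of the 3-row-strip transfer recursion): in the
box `S_L = {0..L} × {0,1,2}` (`discreteDomainGraph (rectDomain L 2) 1`) every self-avoiding path from a
left-column site `(0,r)` to the middle `(L,1)` of the right column meets every self-avoiding path
between the two right corners `(L,2-s)`, `(L,s)` (`s ∈ {0,2}`).

Proof: viewed in `ℤ²` (`Walk.mapLe`), the first path is a left–right crossing of the rectangle
`[0,L] × [0,2]` and the second one (reversed when `s = 0`) is a bottom–top crossing of the same
rectangle; both supports stay in the rectangle (`support_subset_rectSites`), so the discrete Jordan
lemma `Literature.Probability.Percolation.exists_mem_support_of_crossing` gives a common vertex.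
-/

noncomputable section

namespace Summit.CriticalPhenomena.SAWScalingLimit.Theorems.BoundaryTP2

open Literature.Probability.LatticeModels Literature.Probability.RandomPlanarGeometry
open Summit.CriticalPhenomena.SAWScalingLimit.Theorems.EdgeOfPositivity.Negative
open scoped ENNReal

/-- In the box `{0..L} × {0,1,2}`, every walk from a left-column site `(0,r)` to `(L,1)` meets every
walk of the box from a site `c` of the bottom row to a site `d` of the top row: in `ℤ²` the former is
a left–right crossing and the latter a bottom–top crossing of the rectangle `[0,L] × [0,2]`
(`exists_mem_support_of_crossing`). [folklore] -/
private theorem s3il_meet (L : ℕ) {r : ℤ} (hr : 0 ≤ r ∧ r ≤ 2) {c d : Site 2}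
    (hc : c ∈ rectSites L 2) (hc1 : c 1 = 0) (hd1 : d 1 = 2)
    (P : (discreteDomainGraph (rectDomain L 2) 1).Walk (st 0 r) (st L 1))
    (Q : (discreteDomainGraph (rectDomain L 2) 1).Walk c d) :
    ∃ v, v ∈ P.support ∧ v ∈ Q.support := by
  -- adapted from `interlaced_facingPairs` in `…BoundaryTP2RectFacingPairs` (no prolongation needed)
  have hle : discreteDomainGraph (rectDomain L 2) 1 ≤ zdGraph 2 :=
    discreteDomainGraph_le_zdGraph (rectDomain L 2) 1
  have hp : st 0 r ∈ rectSites L 2 := by rw [mem_rectSites_iff, st_zero, st_one]; omega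
  have hP : ∀ z ∈ (P.mapLe hle).support,
      (0 : ℤ) ≤ z 0 ∧ z 0 ≤ (L : ℤ) ∧ (0 : ℤ) ≤ z 1 ∧ z 1 ≤ 2 := by
    intro z hz
    rw [SimpleGraph.Walk.support_mapLe_eq_support] at hz
    have := mem_rectSites_iff.1 (support_subset_rectSites hp P z hz)
    omega
  have hQ : ∀ z ∈ (Q.mapLe hle).support,
      (0 : ℤ) ≤ z 0 ∧ z 0 ≤ (L : ℤ) ∧ (0 : ℤ) ≤ z 1 ∧ z 1 ≤ 2 := by
    intro z hz
    rw [SimpleGraph.Walk.support_mapLe_eq_support] at hz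
    have := mem_rectSites_iff.1 (support_subset_rectSites hc Q z hz)
    omega
  obtain ⟨z, hzP, hzQ⟩ := Literature.Probability.Percolation.exists_mem_support_of_crossing
    (P.mapLe hle) (Q.mapLe hle) hP hQ (st_zero _ _) (st_zero _ _) hc1 hd1
  rw [SimpleGraph.Walk.support_mapLe_eq_support] at hzP hzQ
  exact ⟨z, hzP, hzQ⟩

/-- **Tool stub `stub_strip3_interlaced`** (C4). The planar input of the corner recursion C2: in the
box `{0..L} × {0,1,2}` every self-avoiding path from the left column to the middle `(L,1)` of the
right column meets every self-avoiding path between the two right corners `(L,2-s) → (L,s)`,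
`s ∈ {0,2}` (a left–right crossing meets a top–bottom crossing,
`Literature.Probability.Percolation.exists_mem_support_of_crossing`). [folklore] -/
theorem stub_strip3_interlaced (L : ℕ) (r : ℤ) (hr : 0 ≤ r ∧ r ≤ 2) (s : ℤ) (hs : s = 0 ∨ s = 2) :
    Interlaced (discreteDomainGraph (rectDomain L 2) 1) (st 0 r) (st L (2 - s)) (st L 1) (st L s) := by
  intro P Q
  rcases hs with rfl | rfl
  · -- `Q : (L,2) → (L,0)`: its reverse is a bottom–top crossing
    have hc : st (L : ℤ) 0 ∈ rectSites L 2 := by rw [mem_rectSites_iff, st_zero, st_one]; omega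
    have hd1 : st (L : ℤ) (2 - 0) 1 = 2 := by rw [st_one]; norm_num
    obtain ⟨v, hvP, hvQ⟩ := s3il_meet L hr hc (st_one _ _) hd1 P.1 Q.1.reverse
    rw [SimpleGraph.Walk.support_reverse, List.mem_reverse] at hvQ
    exact ⟨v, hvP, hvQ⟩
  · -- `Q : (L,0) → (L,2)` is a bottom–top crossing
    have hc : st (L : ℤ) (2 - 2) ∈ rectSites L 2 := by
      rw [mem_rectSites_iff, st_zero, st_one]; omega
    have hc1 : st (L : ℤ) (2 - 2) 1 = 0 := by rw [st_one]; norm_num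
    obtain ⟨v, hvP, hvQ⟩ := s3il_meet L hr hc hc1 (st_one _ _) P.1 Q.1
    exact ⟨v, hvP, hvQ⟩

end Summit.CriticalPhenomena.SAWScalingLimit.Theorems.BoundaryTP2
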